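import Mathlib
import HarnessLib
import Summits.NavierStokesRegularity.NavierStokesRegularity.Theorems.LocalSineTubeDoorLocalPointZoomGradSlices
import Summits.NavierStokesRegularity.NavierStokesRegularity.Theorems.LocalSineTubeDoorLocalPointZoomDiag

/-!
# The door family with ONE-SLICE profile cruxes: the SEQUENTIAL (bounded-gap times) door

Cell ns-regularity-ideate, seat p6 (`--supports stmt-NavierStokesRegularity-20017`).  When a door's profile crux needs the
window property on ONE slice only (the sine door: `eq_zero_of_aligned_window`), the time hypothesis «window scalar fades as
`t → T⁻`» weakens to fading along ONE sequence `tₖ → T` in `[0,T)` with bounded gaps `T − tₖ₊₁ ≥ c (T − tₖ)`, `c > 0`: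
`sequentialDoor_of_oneSliceWindowRigidity` (generic continuous first-order scalar `F(x, A)` with scaling-invariant zero set).
Proof: zoom frame (`Λⱼ = Rλⱼ/2`, `τⱼ = Λⱼ²/ν`); the first `k` with `T − tₖ ≤ τⱼ` has `tₖ = T + Λⱼ²sⱼ/ν`, `sⱼ ∈ [−1,−c]`;
Bolzano–Weierstrass `sⱼ → s⋆` along `φ`; in the `√(−s⋆)`-rescaled subsequence frame the window data are rescaled zooms read
at `(sⱼ/(−s⋆), (σ'ⱼ/σ)y) → (−1, (σ∞/σ)y)` — `…LocalPointZoomDiag.localZoomFrame_diag` —; Fatou on the window gives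
`F(v₁(s⋆,·), Dv₁(s⋆)(·)) = 0` on the open window `σ∞ • U`; the one-slice crux concludes.
WHAT THIS IS NOT: not a claim about Navier–Stokes regularity; a door TEMPLATE conditional on the one-slice profile crux given
as a hypothesis (bears_on LADDER-NS N0).
-/

noncomputable section

-- the summit and its single sub-problem share the name (CONVENTIONS §1), as in every Theorems file
set_option linter.dupNamespace false

namespace Summit.NavierStokesRegularity.NavierStokesRegularity.Theorems.LocalSineTubeDoorSequentialDoor

open MeasureTheory Set Function Filter Topology TopologicalSpace Metric
open scoped RealInnerProductSpace InnerProductSpace NNReal ENNReal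
open Literature.Analysis Literature.Analysis.FluidPDE Literature.Analysis.FluidPDE.SereginSverak2009
open Summit.NavierStokesRegularity.NavierStokesRegularity.Theorems
open Summit.NavierStokesRegularity.NavierStokesRegularity.Theorems.LocalSineTubeDoorProfileAlignedWindowRigidityAncient
open Summit.NavierStokesRegularity.NavierStokesRegularity.Theorems.LocalSineTubeDoorLocalPointZoomFrame
open Summit.NavierStokesRegularity.NavierStokesRegularity.Theorems.LocalSineTubeDoorLocalPointZoomSlices
open Summit.NavierStokesRegularity.NavierStokesRegularity.Theorems.LocalSineTubeDoorLocalPointZoomGradSlices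
open Summit.NavierStokesRegularity.NavierStokesRegularity.Theorems.LocalSineTubeDoorLocalPointZoomDiag

/-- **THE SEQUENTIAL DOOR for one-slice profile cruxes (first-order scalars).**  See the module docstring. -/
theorem sequentialDoor_of_oneSliceWindowRigidity
    (F : EuclideanSpace ℝ (Fin 3) → (EuclideanSpace ℝ (Fin 3) →L[ℝ] EuclideanSpace ℝ (Fin 3)) → ℝ)
    (hF : Continuous fun q : EuclideanSpace ℝ (Fin 3) × (EuclideanSpace ℝ (Fin 3) →L[ℝ] EuclideanSpace ℝ (Fin 3)) =>
      F q.1 q.2)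
    (hzero : ∀ (a b : ℝ), 0 < a → 0 < b → ∀ (x : EuclideanSpace ℝ (Fin 3))
      (A : EuclideanSpace ℝ (Fin 3) →L[ℝ] EuclideanSpace ℝ (Fin 3)), F (a • x) (b • A) = 0 ↔ F x A = 0)
    (hcrux : ∀ (C : ℝ) (v : ℝ → EuclideanSpace ℝ (Fin 3) → EuclideanSpace ℝ (Fin 3)),
      Literature.Analysis.FluidPDE.HasTypeITimeDecay C v →
      ContinuousOn (Function.uncurry v) (Set.Iio (0 : ℝ) ×ˢ Set.univ) →
      (∀ s t : ℝ, s < t → t < 0 → ∀ x, v t x =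
        Literature.Analysis.UnboundedOperators.heatExtension (v s) (t - s) x -
          Literature.Analysis.FluidPDE.oseenDuhamel 1 s v v t x) →
      (∀ t < 0, Literature.Analysis.FluidPDE.VectorCalculus.IsDivFree (v t)) →
      (∃ s < 0, ∃ U : Set (EuclideanSpace ℝ (Fin 3)), IsOpen U ∧ U.Nonempty ∧
        ∀ z ∈ U, F (v s z) (fderiv ℝ (v s) z) = 0) →
      ¬ Literature.Analysis.FluidPDE.IsBackwardSingularPoint v 0) :
    ∀ (ν T : ℝ), 0 < ν → 0 < T → ∀ (u : ℝ → EuclideanSpace ℝ (Fin 3) → EuclideanSpace ℝ (Fin 3))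
      (p : ℝ → EuclideanSpace ℝ (Fin 3) → ℝ),
    Literature.Analysis.FluidPDE.IsClassicalNSSolutionOn (Set.Ico 0 T) ν 0 u p →
    Literature.Analysis.FluidPDE.IsLerayHopfOn T ν 0 (u 0) u →
    Literature.Analysis.FluidPDE.HasRapidSpatialDecay (u 0) →
    ∀ (x₀ : EuclideanSpace ℝ (Fin 3)) (ρ M : ℝ), 0 < ρ →
    (∀ t ∈ Set.Ico 0 T, T - ρ ^ 2 < t → ∀ x ∈ Metric.ball x₀ ρ, ‖u t x‖ * Real.sqrt (ν * (T - t)) ≤ M) →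
    ∀ (U : Set (EuclideanSpace ℝ (Fin 3))), IsOpen U → U.Nonempty →
    ∀ (t : ℕ → ℝ) (c : ℝ), 0 < c → (∀ k, t k ∈ Set.Ico 0 T) → Filter.Tendsto t Filter.atTop (nhds T) →
    (∀ k, c * (T - t k) ≤ T - t (k + 1)) →
    Filter.Tendsto (fun k => ∫⁻ y in U, ENNReal.ofReal
      |F (Real.sqrt (T - t k) • u (t k) (x₀ + Real.sqrt (T - t k) • y))
        (Real.sqrt (T - t k) ^ 2 • fderiv ℝ (u (t k)) (x₀ + Real.sqrt (T - t k) • y))|)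
      Filter.atTop (nhds 0) →
    Literature.Analysis.FluidPDE.IsBackwardBoundedAt u T x₀ := by
  intro ν T hν hT u p hsol hLH _ x₀ ρ M hρ hM U hU hUne t c hc htk htT hgap hfade
  by_contra hnotbd
  obtain ⟨R, C₁, v', π', lam, w, v₁, Ks, r₁, hR, hlam, hlam0, hball1, hr₁, hr₁1, hKs, hL3, hae, hP,
    hsing₁, hpt⟩ := localTreeZoomFrame hν hT hsol hLH hρ hM hnotbd
  refine hcrux C₁ v₁ hP.1 hP.2.1 hP.2.2.1 hP.2.2.2 ?_ hsing₁
  have hΛ : ∀ j, 0 < R * (lam j / 2) := fun j => mul_pos hR (half_pos (hlam j))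
  set τ : ℕ → ℝ := fun j => (R * (lam j / 2)) ^ 2 / ν with hτdef
  have hτ : ∀ j, 0 < τ j := fun j => div_pos (pow_pos (hΛ j) 2) hν
  have hτ0 : Tendsto τ atTop (𝓝 0) := by
    simpa using (((hlam0.div_const 2).const_mul R).pow 2).div_const ν
  have hgpos : ∀ k, 0 < T - t k := fun k => sub_pos.2 (htk k).2
  have hg0 : Tendsto (fun k => T - t k) atTop (𝓝 0) := by simpa using (tendsto_const_nhds (x := T)).sub htT
  have hsmall : ∀ {ε : ℝ}, 0 < ε → ∀ᶠ k in atTop, T - t k < ε := fun {ε} hε =>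
    (Metric.tendsto_nhds.1 hg0 ε hε).mono fun k hk => by rwa [Real.dist_eq, sub_zero, abs_of_pos (hgpos k)] at hk
  have hτsmall : ∀ {ε : ℝ}, 0 < ε → ∀ᶠ j in atTop, τ j < ε := fun {ε} hε =>
    (Metric.tendsto_nhds.1 hτ0 ε hε).mono fun j hj => by rwa [Real.dist_eq, sub_zero, abs_of_pos (hτ j)] at hj
  -- ## selection: the first `k` with `T − tₖ ≤ τⱼ`
  have hex : ∀ j, ∃ k, T - t k ≤ τ j := fun j => by
    obtain ⟨k, hk⟩ := (hsmall (hτ j)).exists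
    exact ⟨k, hk.le⟩
  classical
  set kk : ℕ → ℕ := fun j => Nat.find (hex j) with hkkdef
  have hkk_le : ∀ j, T - t (kk j) ≤ τ j := fun j => Nat.find_spec (hex j)
  have hkk_min : ∀ j k, k < kk j → τ j < T - t k := fun j k hk =>
    lt_of_not_ge (Nat.find_min (hex j) hk)
  have hsel : ∀ᶠ j in atTop, c * τ j < T - t (kk j) := by
    filter_upwards [hτsmall (hgpos 0)] with j hj
    have hk0 : kk j ≠ 0 := by
      intro h0
      have h1 := hkk_le j
      rw [h0] at h1
      linarith
    obtain ⟨m, hm⟩ := Nat.exists_eq_succ_of_ne_zero hk0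
    have h1 : τ j < T - t m := hkk_min j m (by omega)
    calc c * τ j < c * (T - t m) := mul_lt_mul_of_pos_left h1 hc
      _ ≤ T - t (m + 1) := hgap m
      _ = T - t (kk j) := by rw [hm]
  have hkk : Tendsto kk atTop atTop := by
    refine tendsto_atTop_atTop.2 fun K => ?_
    have hall : ∀ᶠ j in atTop, ∀ i : Fin K, τ j < T - t i :=
      eventually_all.2 fun i => hτsmall (hgpos i)
    obtain ⟨J, hJ⟩ := eventually_atTop.1 hall
    refine ⟨J, fun j hj => ?_⟩
    by_contra hlt
    push Not at hlt
    have h1 := hJ j hj ⟨kk j, hlt⟩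
    exact absurd (hkk_le j) (not_le.2 h1)
  -- ## the slice parameters `sⱼ = −(T − t_{k(j)})/τⱼ ∈ [−1, −c]` (eventually) and a convergent subsequence
  set sq : ℕ → ℝ := fun j => -(T - t (kk j)) / τ j with hsqdef
  have hsq_id : ∀ j, T - t (kk j) = τ j * (-sq j) := by
    intro j
    simp only [hsqdef]
    field_simp [(hτ j).ne']
  have hsq_mem : ∀ᶠ j in atTop, sq j ∈ Icc (-1 : ℝ) (-c) := by
    filter_upwards [hsel] with j hj
    refine ⟨?_, ?_⟩
    · simp only [hsqdef]
      rw [neg_div, neg_le_neg_iff, div_le_one (hτ j)]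
      exact hkk_le j
    · simp only [hsqdef]
      rw [neg_div, neg_le_neg_iff, le_div_iff₀ (hτ j)]
      exact hj.le
  obtain ⟨sstar, hsstar_mem, φ, hφ, hsφ⟩ := tendsto_subseq_of_frequently_bounded (isCompact_Icc.isBounded)
    (hsq_mem.frequently)
  rw [closure_Icc] at hsstar_mem
  have hφt : Tendsto φ atTop atTop := hφ.tendsto_atTop
  have hsstar : sstar < 0 := by linarith [hsstar_mem.2]
  have hns : 0 < -sstar := neg_pos.2 hsstar
  set lamφ : ℕ → ℝ := fun j => lam (φ j) with hlamφdef
  have hlamφ : ∀ j, 0 < lamφ j := fun j => hlam (φ j)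
  have hlam0φ : Tendsto lamφ atTop (𝓝 0) := hlam0.comp hφt
  have hptφ : ∀ (j : ℕ) (s' : ℝ) (y' : EuclideanSpace ℝ (Fin 3)),
      ((lamφ j) • stPull ((lamφ j) ^ 2) (lamφ j) (0 : ℝ) (0 : (EuclideanSpace ℝ (Fin 3))) v') s' y' =
        ((R * (lamφ j / 2)) / ν) • u (T + (R * (lamφ j / 2)) ^ 2 * s' / ν) (x₀ + (R * (lamφ j / 2)) • y') :=
    fun j => hpt (φ j)
  have hL3φ : ∀ a : ℝ, 0 < a → Tendsto (fun j => eLpNorm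
      (uncurry ((lamφ j) • stPull ((lamφ j) ^ 2) (lamφ j) (0 : ℝ) (0 : (EuclideanSpace ℝ (Fin 3))) v') - uncurry w) 3
      (volume.restrict (parabolicCylinder a (0 : ℝ × (EuclideanSpace ℝ (Fin 3)))))) atTop (𝓝 0) :=
    fun a ha => (hL3 a ha).comp hφt
  set σ : ℝ := Real.sqrt (-sstar) with hσdef
  have hσ : 0 < σ := Real.sqrt_pos.2 hns
  have hσ2 : σ ^ 2 = -sstar := Real.sq_sqrt hns.le
  have hσne : σ ≠ 0 := hσ.ne'
  set lam' : ℕ → ℝ := fun j => σ * lamφ j with hlam'def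
  have hlam' : ∀ j, 0 < lam' j := fun j => mul_pos hσ (hlamφ j)
  have hlam0' : Tendsto lam' atTop (𝓝 0) := by
    show Tendsto (fun j => σ * lamφ j) atTop (𝓝 0)
    simpa using hlam0φ.const_mul σ
  set w' : ℝ → (EuclideanSpace ℝ (Fin 3)) → (EuclideanSpace ℝ (Fin 3)) :=
    σ • stPull (σ ^ 2) σ (0 : ℝ) (0 : (EuclideanSpace ℝ (Fin 3))) w with hw'def
  set v₁' : ℝ → (EuclideanSpace ℝ (Fin 3)) → (EuclideanSpace ℝ (Fin 3)) :=
    σ • stPull (σ ^ 2) σ (0 : ℝ) (0 : (EuclideanSpace ℝ (Fin 3))) v₁ with hv₁'def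
  have hZZ : ∀ j, (lam' j) • stPull ((lam' j) ^ 2) (lam' j) (0 : ℝ) (0 : (EuclideanSpace ℝ (Fin 3))) v' =
      σ • stPull (σ ^ 2) σ (0 : ℝ) (0 : (EuclideanSpace ℝ (Fin 3)))
        ((lamφ j) • stPull ((lamφ j) ^ 2) (lamφ j) (0 : ℝ) (0 : (EuclideanSpace ℝ (Fin 3))) v') := by
    intro j
    simp only [hlam'def]
    rw [zoom_zoom]
  have hpt' : ∀ (j : ℕ) (s' : ℝ) (y' : (EuclideanSpace ℝ (Fin 3))),
      ((lam' j) • stPull ((lam' j) ^ 2) (lam' j) (0 : ℝ) (0 : (EuclideanSpace ℝ (Fin 3))) v') s' y' =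
        ((R * (lam' j / 2)) / ν) • u (T + (R * (lam' j / 2)) ^ 2 * s' / ν) (x₀ + (R * (lam' j / 2)) • y') := by
    intro j s' y'
    have h := hptφ j (σ ^ 2 * s') (σ • y')
    simp only [smul_stPull_apply, zero_add] at h ⊢
    simp only [hlam'def]
    rw [show (σ * lamφ j) ^ 2 * s' = lamφ j ^ 2 * (σ ^ 2 * s') by ring,
      show (σ * lamφ j) • y' = lamφ j • σ • y' by rw [smul_smul, mul_comm],
      mul_smul, h, smul_smul, smul_smul,
      show σ * (R * (lamφ j / 2) / ν) = R * (σ * lamφ j / 2) / ν by ring,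
      show T + (R * (lamφ j / 2)) ^ 2 * (σ ^ 2 * s') / ν = T + (R * (σ * lamφ j / 2)) ^ 2 * s' / ν by ring,
      show R * (lamφ j / 2) * σ = R * (σ * lamφ j / 2) by ring]
  have hus : ∀ f g : ℝ → (EuclideanSpace ℝ (Fin 3)) → (EuclideanSpace ℝ (Fin 3)),
      uncurry (f - g) = uncurry f - uncurry g := fun f g => rfl
  have hL3' : ∀ a : ℝ, 0 < a → Tendsto (fun j => eLpNorm
      (uncurry ((lam' j) • stPull ((lam' j) ^ 2) (lam' j) (0 : ℝ) (0 : (EuclideanSpace ℝ (Fin 3))) v') - uncurry w') 3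
      (volume.restrict (parabolicCylinder a (0 : ℝ × (EuclideanSpace ℝ (Fin 3)))))) atTop (𝓝 0) := by
    intro a ha
    have hdiff : ∀ j, uncurry ((lam' j) • stPull ((lam' j) ^ 2) (lam' j) (0 : ℝ) (0 : (EuclideanSpace ℝ (Fin 3))) v') -
        uncurry w' = uncurry (σ • stPull (σ ^ 2) σ (0 : ℝ) (0 : (EuclideanSpace ℝ (Fin 3)))
          ((lamφ j) • stPull ((lamφ j) ^ 2) (lamφ j) (0 : ℝ) (0 : (EuclideanSpace ℝ (Fin 3))) v' - w)) := by
      intro j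
      rw [hZZ j]
      funext z
      obtain ⟨s', y'⟩ := z
      simp only [hw'def, uncurry_apply_pair, Pi.sub_apply, smul_stPull_apply, smul_sub]
    have hconst : (‖σ‖ₑ * (ENNReal.ofReal ((σ ^ 2 * σ ^ 3)⁻¹)) ^ (1 / (3 : ℝ≥0∞).toReal)) ≠ ⊤ :=
      ENNReal.mul_ne_top enorm_ne_top
        (ENNReal.rpow_ne_top_of_nonneg (one_div_nonneg.2 ENNReal.toReal_nonneg) ENNReal.ofReal_ne_top)
    have key := ENNReal.Tendsto.const_mul (hL3φ (a * σ) (mul_pos ha hσ)) (Or.inr hconst)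
    rw [mul_zero] at key
    refine key.congr fun j => ?_
    rw [hdiff j]
    conv_rhs => rw [show a = a * σ / σ by field_simp]
    rw [eLpNorm_uncurry_zoom hσ σ _ (a * σ) three_ne_zero ENNReal.ofNat_ne_top, hus]
  have hslab : stAffine (σ ^ 2) σ (0 : ℝ) (0 : (EuclideanSpace ℝ (Fin 3))) ⁻¹'
      (Iio (0 : ℝ) ×ˢ (univ : Set (EuclideanSpace ℝ (Fin 3)))) =
      Iio (0 : ℝ) ×ˢ (univ : Set (EuclideanSpace ℝ (Fin 3))) := by
    ext z
    simp only [mem_preimage, mem_prod, mem_Iio, mem_univ, and_true, stAffine_fst, zero_add]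
    exact ⟨fun h => neg_of_mul_neg_right h (pow_pos hσ 2).le,
      fun h => mul_neg_of_pos_of_neg (pow_pos hσ 2) h⟩
  have hae' : ∀ᵐ x ∂(volume.restrict (Iio (0 : ℝ) ×ˢ (univ : Set (EuclideanSpace ℝ (Fin 3))))),
      uncurry w' x = uncurry v₁' x := by
    have h := ae_eq_restrict_comp_stAffine (f := uncurry w) (g := uncurry v₁) (pow_pos hσ 2) hσ
      (0 : ℝ) (0 : (EuclideanSpace ℝ (Fin 3))) hae
    rw [hslab] at h
    filter_upwards [h] with z hz
    show σ • uncurry w (stAffine (σ ^ 2) σ (0 : ℝ) (0 : (EuclideanSpace ℝ (Fin 3))) z) =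
      σ • uncurry v₁ (stAffine (σ ^ 2) σ (0 : ℝ) (0 : (EuclideanSpace ℝ (Fin 3))) z)
    rw [show uncurry w (stAffine (σ ^ 2) σ (0 : ℝ) (0 : (EuclideanSpace ℝ (Fin 3))) z) =
      uncurry v₁ (stAffine (σ ^ 2) σ (0 : ℝ) (0 : (EuclideanSpace ℝ (Fin 3))) z) from hz]
  have hrate' : HasTypeITimeDecay C₁ v₁' := rate_smul_stPull hP.1 hσ
  have hcont' : ContinuousOn (uncurry v₁') (Iio (0 : ℝ) ×ˢ univ) := cont_smul_stPull hP.2.1 hσ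
  have hmild' := mild_smul_stPull hP.2.2.1 hσ
  set σ' : ℕ → ℝ := fun j => Real.sqrt (-sq (φ j)) / Real.sqrt ν with hσ'def
  set σinf : ℝ := Real.sqrt (-sstar) / Real.sqrt ν with hσinfdef
  have hσinf : 0 < σinf := div_pos (Real.sqrt_pos.2 hns) (Real.sqrt_pos.2 hν)
  have hσ'lim : Tendsto σ' atTop (𝓝 σinf) :=
    ((Real.continuous_sqrt.tendsto _).comp hsφ.neg).div_const _
  have hsseq : Tendsto (fun j => sq (φ j) / σ ^ 2) atTop (𝓝 (-1)) := by
    rw [hσ2]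
    have h := hsφ.div_const (-sstar)
    rw [show sstar / -sstar = (-1 : ℝ) by rw [div_neg, div_self hsstar.ne]] at h
    exact h
  have hsqneg : ∀ᶠ j in atTop, sq (φ j) < 0 :=
    (hφt.eventually hsq_mem).mono fun j hj => by linarith [hj.2]
  set W : ℕ → EuclideanSpace ℝ (Fin 3) → EuclideanSpace ℝ (Fin 3) := fun j y =>
    Real.sqrt (T - t (kk (φ j))) • u (t (kk (φ j))) (x₀ + Real.sqrt (T - t (kk (φ j))) • y) with hWdef
  set G : ℕ → EuclideanSpace ℝ (Fin 3) → (EuclideanSpace ℝ (Fin 3) →L[ℝ] EuclideanSpace ℝ (Fin 3)) := fun j y =>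
    Real.sqrt (T - t (kk (φ j))) ^ 2 • fderiv ℝ (u (t (kk (φ j)))) (x₀ + Real.sqrt (T - t (kk (φ j))) • y) with hGdef
  have hsqrt : ∀ j, sq (φ j) < 0 → Real.sqrt (T - t (kk (φ j))) = (R * (lamφ j / 2)) * σ' j := by
    intro j hj
    have hid : T - t (kk (φ j)) = (R * (lamφ j / 2)) ^ 2 * (-sq (φ j) / ν) := by
      rw [hsq_id (φ j)]
      simp only [hτdef, hlamφdef]
      field_simp
    rw [hid, hσ'def, Real.sqrt_mul (pow_nonneg (hΛ (φ j)).le 2), Real.sqrt_sq (hΛ (φ j)).le,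
      Real.sqrt_div' _ hν.le]
  have htime : ∀ j, t (kk (φ j)) = T + (R * (lamφ j / 2)) ^ 2 * sq (φ j) / ν := by
    intro j
    have h := hsq_id (φ j)
    simp only [hτdef, hlamφdef] at h ⊢
    have hν' : ν ≠ 0 := hν.ne'
    field_simp at h
    field_simp
    linarith
  have hW : ∀ j, sq (φ j) < 0 → ∀ y : EuclideanSpace ℝ (Fin 3), W j y =
      (σ' j * ν / σ) • ((lam' j) • stPull ((lam' j) ^ 2) (lam' j) (0 : ℝ) (0 : (EuclideanSpace ℝ (Fin 3))) v')
        (sq (φ j) / σ ^ 2) ((σ' j / σ) • y) := by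
    intro j hj y
    have e1 : σ' j * ν / σ * (R * (σ * lamφ j / 2) / ν) = R * (lamφ j / 2) * σ' j := by
      field_simp
    have e2 : T + (R * (σ * lamφ j / 2)) ^ 2 * (sq (φ j) / σ ^ 2) / ν = T + (R * (lamφ j / 2)) ^ 2 * sq (φ j) / ν := by
      field_simp
    have e3 : R * (σ * lamφ j / 2) * (σ' j / σ) = R * (lamφ j / 2) * σ' j := by
      field_simp
    rw [hpt' j]
    simp only [hWdef]
    rw [hsqrt j hj, htime j]
    simp only [hlam'def, smul_smul]
    rw [e1, e2, e3]
  have hG : ∀ j, sq (φ j) < 0 → ∀ y : EuclideanSpace ℝ (Fin 3), G j y =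
      (σ' j ^ 2 * ν / σ ^ 2) • fderiv ℝ (((lam' j) • stPull ((lam' j) ^ 2) (lam' j) (0 : ℝ)
        (0 : (EuclideanSpace ℝ (Fin 3))) v') (sq (φ j) / σ ^ 2)) ((σ' j / σ) • y) := by
    intro j hj y
    have hfun : ((lam' j) • stPull ((lam' j) ^ 2) (lam' j) (0 : ℝ) (0 : (EuclideanSpace ℝ (Fin 3))) v')
        (sq (φ j) / σ ^ 2) = (((R * (lam' j / 2)) / ν) • stPull ((R * (lam' j / 2)) ^ 2 / ν) (R * (lam' j / 2)) T x₀ u)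
          (sq (φ j) / σ ^ 2) := by
      funext y'
      rw [hpt' j, smul_stPull_apply]
      congr 2
      ring
    have e2 : T + (R * (σ * lamφ j / 2)) ^ 2 / ν * (sq (φ j) / σ ^ 2) = T + (R * (lamφ j / 2)) ^ 2 * sq (φ j) / ν := by
      field_simp
    have e3 : R * (σ * lamφ j / 2) * (σ' j / σ) = R * (lamφ j / 2) * σ' j := by
      field_simp
    have e4 : σ' j ^ 2 * ν / σ ^ 2 * (R * (σ * lamφ j / 2) / ν * (R * (σ * lamφ j / 2))) =
        (R * (lamφ j / 2) * σ' j) ^ 2 := by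
      field_simp
    rw [hfun, fderiv_smul_stPull]
    simp only [hGdef]
    rw [hsqrt j hj, htime j]
    simp only [hlam'def, smul_smul]
    rw [e2, e3, e4]
  -- ## diagonal convergence in the rescaled subsequence frame, at the base point `(σ∞/σ) y`
  have hdiag : ∀ y : EuclideanSpace ℝ (Fin 3),
      Tendsto (fun j => ((lam' j) • stPull ((lam' j) ^ 2) (lam' j) (0 : ℝ) (0 : (EuclideanSpace ℝ (Fin 3))) v')
        (sq (φ j) / σ ^ 2) ((σ' j / σ) • y)) atTop (𝓝 (v₁' (-1) ((σinf / σ) • y))) ∧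
      Tendsto (fun j => fderiv ℝ (((lam' j) • stPull ((lam' j) ^ 2) (lam' j) (0 : ℝ) (0 : (EuclideanSpace ℝ (Fin 3))) v')
        (sq (φ j) / σ ^ 2)) ((σ' j / σ) • y)) atTop (𝓝 (fderiv ℝ (v₁' (-1)) ((σinf / σ) • y))) := fun y =>
    localZoomFrame_diag hν hT hsol.smooth_velocity.continuousOn hρ hM hR hball1 hlam' hlam0' hr₁ hr₁1 hKs hpt'
      hL3' hae' hrate' hcont' hmild' ((σinf / σ) • y) hsseq ((hσ'lim.div_const σ).smul_const y)
  have hv₁'val : ∀ y : EuclideanSpace ℝ (Fin 3), v₁' (-1) ((σinf / σ) • y) = σ • v₁ sstar (σinf • y) := by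
    intro y
    simp only [hv₁'def, smul_stPull_apply, smul_smul, zero_add]
    rw [show σ ^ 2 * (-1) = sstar by rw [hσ2]; ring, show σ * (σinf / σ) = σinf by field_simp]
  have hDv₁'val : ∀ y : EuclideanSpace ℝ (Fin 3),
      fderiv ℝ (v₁' (-1)) ((σinf / σ) • y) = (σ * σ) • fderiv ℝ (v₁ sstar) (σinf • y) := by
    intro y
    simp only [hv₁'def]
    rw [fderiv_smul_stPull]
    simp only [smul_smul, zero_add]
    rw [show σ ^ 2 * (-1) = sstar by rw [hσ2]; ring, show σ * (σinf / σ) = σinf by field_simp]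
  have hconvW : ∀ y, Tendsto (fun j => W j y) atTop (𝓝 ((σinf * ν) • v₁ sstar (σinf • y))) := by
    intro y
    have h := ((hσ'lim.mul_const ν).div_const σ).smul (hdiag y).1
    rw [hv₁'val, smul_smul, show σinf * ν / σ * σ = σinf * ν by field_simp] at h
    refine h.congr' ?_
    filter_upwards [hsqneg] with j hj
    exact (hW j hj y).symm
  have hconvG : ∀ y, Tendsto (fun j => G j y) atTop (𝓝 ((σinf ^ 2 * ν) • fderiv ℝ (v₁ sstar) (σinf • y))) := by
    intro y
    have h := (((hσ'lim.pow 2).mul_const ν).div_const (σ ^ 2)).smul (hdiag y).2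
    rw [hDv₁'val, smul_smul, show σinf ^ 2 * ν / σ ^ 2 * (σ * σ) = σinf ^ 2 * ν by field_simp] at h
    refine h.congr' ?_
    filter_upwards [hsqneg] with j hj
    exact (hG j hj y).symm
  set Hs : EuclideanSpace ℝ (Fin 3) → ℝ := fun y =>
    F ((σinf * ν) • v₁ sstar (σinf • y)) ((σinf ^ 2 * ν) • fderiv ℝ (v₁ sstar) (σinf • y)) with hHsdef
  have han : AnalyticOnNhd ℝ (v₁ sstar) univ :=
    analyticOnNhd_slice hP.2.1 (bdd_of_hasTypeITimeDecay hP.1) hP.2.2.1 hsstar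
  have hvs : Continuous (v₁ sstar) := by
    rw [← continuousOn_univ]; exact han.continuousOn
  have hDvs : Continuous (fderiv ℝ (v₁ sstar)) := (han.contDiff (n := 1)).continuous_fderiv one_ne_zero
  have hHscont : Continuous Hs := by
    show Continuous fun y => F ((σinf * ν) • v₁ sstar (σinf • y)) ((σinf ^ 2 * ν) • fderiv ℝ (v₁ sstar) (σinf • y))
    exact hF.comp ((((hvs.comp (continuous_const_smul σinf)).const_smul (σinf * ν)).prodMk
      ((hDvs.comp (continuous_const_smul σinf)).const_smul (σinf ^ 2 * ν))))
  have hconvH : ∀ y, Tendsto (fun j => F (W j y) (G j y)) atTop (𝓝 (Hs y)) := fun y =>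
    (hF.tendsto _).comp ((hconvW y).prodMk_nhds (hconvG y))
  have hφc : ∀ j, Continuous fun y : EuclideanSpace ℝ (Fin 3) => x₀ + Real.sqrt (T - t (kk (φ j))) • y :=
    fun j => continuous_const.add (continuous_const_smul _)
  have hWc : ∀ j, Continuous (W j) := fun j => by
    show Continuous fun y => Real.sqrt (T - t (kk (φ j))) • u (t (kk (φ j))) (x₀ + Real.sqrt (T - t (kk (φ j))) • y)
    exact ((hsol.contDiff_velocity (htk _)).continuous.comp (hφc j)).const_smul (Real.sqrt (T - t (kk (φ j))))
  have hGc : ∀ j, Continuous (G j) := fun j => by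
    show Continuous fun y =>
      Real.sqrt (T - t (kk (φ j))) ^ 2 • fderiv ℝ (u (t (kk (φ j)))) (x₀ + Real.sqrt (T - t (kk (φ j))) • y)
    exact (((hsol.contDiff_velocity (htk _)).continuous_fderiv (by norm_cast)).comp (hφc j)).const_smul
      (Real.sqrt (T - t (kk (φ j))) ^ 2)
  have hFjc : ∀ j, Continuous fun y => F (W j y) (G j y) := fun j => hF.comp ((hWc j).prodMk (hGc j))
  have hfadej : Tendsto (fun j => ∫⁻ y in U, ENNReal.ofReal |F (W j y) (G j y)|) atTop (𝓝 0) :=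
    hfade.comp (hkk.comp hφt)
  set g : EuclideanSpace ℝ (Fin 3) → ℝ≥0∞ := fun y => ENNReal.ofReal |Hs y| with hg
  have hgc : Continuous g := ENNReal.continuous_ofReal.comp (continuous_abs.comp hHscont)
  have hgjm : ∀ j, Measurable fun y => ENNReal.ofReal |F (W j y) (G j y)| :=
    fun j => (ENNReal.continuous_ofReal.comp (continuous_abs.comp (hFjc j))).measurable
  have hptw : ∀ y, Tendsto (fun j => ENNReal.ofReal |F (W j y) (G j y)|) atTop (𝓝 (g y)) :=
    fun y => ENNReal.tendsto_ofReal ((continuous_abs.tendsto (Hs y)).comp (hconvH y))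
  have hFatou : ∫⁻ y in U, liminf (fun j => ENNReal.ofReal |F (W j y) (G j y)|) atTop ≤
      liminf (fun j => ∫⁻ y in U, ENNReal.ofReal |F (W j y) (G j y)|) atTop :=
    lintegral_liminf_le' (fun j => (hgjm j).aemeasurable)
  have hlim : (fun y => liminf (fun j => ENNReal.ofReal |F (W j y) (G j y)|) atTop) = g :=
    funext fun y => (hptw y).liminf_eq
  rw [hlim, hfadej.liminf_eq] at hFatou
  have hint : ∫⁻ y in U, g y = 0 := le_antisymm hFatou bot_le
  have hae0 : ∀ᵐ y ∂(volume.restrict U), g y = 0 := (lintegral_eq_zero_iff hgc.measurable).1 hint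
  rw [ae_restrict_iff' hU.measurableSet] at hae0
  have hzeroU : ∀ y ∈ U, g y = 0 := by
    intro y hy
    by_contra hne
    set O : Set (EuclideanSpace ℝ (Fin 3)) := U ∩ g ⁻¹' (Ioi 0) with hO
    have hOo : IsOpen O := hU.inter (isOpen_Ioi.preimage hgc)
    have hO0 : volume O = 0 := by
      rw [measure_eq_zero_iff_ae_notMem]
      filter_upwards [hae0] with y' hy'
      rintro ⟨h1, h2⟩
      have := hy' h1
      simp only [mem_preimage, mem_Ioi, this, lt_self_iff_false] at h2
    have hOe : O = ∅ := (hOo.measure_eq_zero_iff volume).1 hO0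
    have hyO : y ∈ O := ⟨hy, by simpa [mem_preimage, mem_Ioi, pos_iff_ne_zero] using hne⟩
    rw [hOe] at hyO
    exact hyO
  -- ## the one-slice window in profile coordinates: `σ∞ • U` at the slice `s⋆`
  refine ⟨sstar, hsstar, (fun z => σinf⁻¹ • z) ⁻¹' U, hU.preimage (continuous_const_smul σinf⁻¹), ?_, fun z hz => ?_⟩
  · obtain ⟨u₀, hu₀⟩ := hUne
    refine ⟨σinf • u₀, ?_⟩
    show σinf⁻¹ • (σinf • u₀) ∈ U
    rwa [smul_smul, inv_mul_cancel₀ hσinf.ne', one_smul]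
  · have h := hzeroU (σinf⁻¹ • z) hz
    simp only [hg, ENNReal.ofReal_eq_zero] at h
    have h0 : Hs (σinf⁻¹ • z) = 0 := abs_eq_zero.1 (le_antisymm h (abs_nonneg _))
    simp only [hHsdef, smul_smul, mul_inv_cancel₀ hσinf.ne', one_smul] at h0
    exact (hzero _ _ (mul_pos hσinf hν) (mul_pos (pow_pos hσinf 2) hν) _ _).1 h0

end Summit.NavierStokesRegularity.NavierStokesRegularity.Theorems.LocalSineTubeDoorSequentialDoor

end
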